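import Summits.BirchSwinnertonDyer.BirchSwinnertonDyer.Theorems.ByReductionTypeAtTwoTorsionEulerCharH46OfT1
import Literature.NumberTheory.EllipticCurves.RationalTorsionKernelOfReductionCriterion
import HarnessLib

set_option linter.dupNamespace false -- `…BirchSwinnertonDyer.BirchSwinnertonDyer…` is the cell's nested layout (D-0017)
set_option autoImplicit false

/-!
# H46 kernel programme (road C′): `H46` and the `p = 2` Euler-characteristic display from a CHECKABLE torsion condition

Cell `bsd-2adic` (run/shared/lean/pub/bsd-2adic/), seat `bsd-2adic-tower-1` GEN 35; `--supports stmt-BirchSwinnertonDyer-19271`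
(helper, item `OrdKatoHalfAtTwo`, TOWER road). THEOREMS ONLY; closes no item; nothing booked; BSD is not proved by any of this.

The side condition (T₁) of `…H46OfT1` («no rational `p`-power torsion point maps into `E₁(ℚ̄_p)`») follows from the per-curve
CHECKABLE condition

  (Int_p) every rational affine point `(x₀, y₀)` of the globally minimal model `W` whose image in `E(ℚ̄)` is `p`-power torsion has
          `p`-integral `x₀` (`vp.valuation ℚ x₀ ≤ 1`)

(`RationalTorsionKernelOfReductionCriterion.t1_of_forall_valuation_le_one`, Silverman VII.1.3(b) + VII.2.2). Hence `H46(W, p, κ, v₀)`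
(`lemma46At_of_forall_valuation_le_one`) and, at `p = 2`, the display `X5.O1.TwoAdicEulerCharRankZero W 0`
(`twoAdicEulerCharRankZero_of_forall_valuation_le_one`) for every curve satisfying (Int₂) — e.g. every curve whose rational points of
order `2` have `2`-integral `x`-coordinates (a rational torsion point with non-integral `x` at `2` has order `2`). For odd `p` no condition
is needed (`…H46OddPrimes`). [cite: GreenbergLNM1716, §4 Lemma 4.6 (p. 105), Thm. 4.1 (p. 102)] [cite: SilvermanAEC2009, Prop. VII.1.3(b), VII.2.2, VII.3.1]
-/

noncomputable section

open scoped Classical NumberField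

namespace Summit.BirchSwinnertonDyer.BirchSwinnertonDyer.Theorems

namespace TorsionEulerChar.H46LevelZero

open CategoryTheory Field NumberField IsDedekindDomain WeierstrassCurve
  Literature.NumberTheory.EllipticCurves Literature.NumberTheory.EllipticCurves.CyclotomicLayer
  Literature.NumberTheory.EllipticCurves.GreenbergSelmer
  Literature.NumberTheory.GaloisRepresentations Literature.NumberTheory.GaloisRepresentations.DiscreteGaloisModule
  Literature.NumberTheory.GaloisCohomology ZpExtension

/-- **`H46(W, p, κ, v₀)` from (Int_p)**: `lemma46At_of_T1` with (T₁) discharged by the coordinate criterion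
`RationalTorsionKernelOfReduction.t1_of_forall_valuation_le_one`. [cite: GreenbergLNM1716, §4 Lemma 4.6 (p. 105)]
[cite: SilvermanAEC2009, Prop. VII.1.3(b), Prop. VII.2.2] -/
theorem lemma46At_of_forall_valuation_le_one (W : WeierstrassCurve ℚ) [W.IsElliptic] [W.IsGloballyMinimal] (p : ℕ)
    [hp : Fact p.Prime] (κ : ZpExtension ℚ p) (hκ : κ.IsCyclotomic) (hord : IsOrdinaryAt W p)
    (S : Finset (HeightOneSpectrum (𝓞 ℚ)))
    (hS : ∀ v : HeightOneSpectrum (𝓞 ℚ), v ∉ S → ((p : ℕ) : 𝓞 ℚ) ∉ v.asIdeal ∧ W.HasGoodReductionAt v)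
    (v₀ : HeightOneSpectrum (𝓞 ℚ)) (hv₀ : v₀ ∉ S) (vp : HeightOneSpectrum (𝓞 ℚ)) (hvp : ((p : ℕ) : 𝓞 ℚ) ∈ vp.asIdeal)
    [Finite (W.selmerGroupPInfty p)]
    (H : ∀ (x₀ y₀ : ℚ) (h : W.toAffine.Nonsingular x₀ y₀),
      (∃ t : ℕ, p ^ t • toGeomPoints W (.some x₀ y₀ h) = 0) → vp.valuation ℚ x₀ ≤ 1)
    (z : discreteH1 (localSubgroup (⊤ : Subgroup (absoluteGaloisGroup ℚ)) (v₀.adicCompletion ℚ))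
      (localPoints W (v₀.adicCompletion ℚ))) (hz : ∃ k : ℕ, p ^ k • z = 0) :
    ∃ T : W.subgroupH1 p κ.kerSubgroup,
      (∀ v : HeightOneSpectrum (𝓞 ℚ), v ≠ v₀ → ∀ σ : absoluteGaloisGroup ℚ,
        W.conjH1 p κ.kerSubgroup σ T ∈ W.localKerOver p κ.kerSubgroup (v.adicCompletion ℚ)) ∧
      (∀ (w : InfinitePlace ℚ) (σ : absoluteGaloisGroup ℚ),
        W.conjH1 p κ.kerSubgroup σ T ∈ W.localKerOver p κ.kerSubgroup w.Completion) ∧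
      ∀ σ : absoluteGaloisGroup ℚ,
        W.localResOver p κ.kerSubgroup (v₀.adicCompletion ℚ) (W.conjH1 p κ.kerSubgroup σ T) =
          Literature.NumberTheory.EllipticCurves.resOfLe (localPoints W (v₀.adicCompletion ℚ))
            (Subgroup.comap_mono le_top :
              localSubgroup κ.kerSubgroup (v₀.adicCompletion ℚ) ≤
                localSubgroup (⊤ : Subgroup (absoluteGaloisGroup ℚ)) (v₀.adicCompletion ℚ)) z :=
  lemma46At_of_T1 W p κ hκ hord S hS v₀ hv₀ vp hvp
    (RationalTorsionKernelOfReduction.t1_of_forall_valuation_le_one W vp p H) z hz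

open Summit.BirchSwinnertonDyer.Rank1Residual.X5.O1 in
/-- **`p = 2`: the display `TwoAdicEulerCharRankZero W 0` from (Int₂)** — rational `2`-torsion ALLOWED provided every rational
`2`-power-torsion affine point of the globally minimal model has `2`-integral `x`-coordinate (`twoAdicEulerCharRankZero_of_T1` with
(T₁) discharged by `RationalTorsionKernelOfReduction.t1_of_forall_valuation_le_one`).
[cite: GreenbergLNM1716, Thm. 4.1 (p. 102), §4 Lemmas 4.6–4.7 (pp. 105–108)] [cite: SilvermanAEC2009, Prop. VII.1.3(b), Prop. VII.2.2] -/
theorem twoAdicEulerCharRankZero_of_forall_valuation_le_one (W : WeierstrassCurve ℚ) [W.IsElliptic] [W.IsGloballyMinimal]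
    (v2 : HeightOneSpectrum (𝓞 ℚ)) (hv2 : ((2 : ℕ) : 𝓞 ℚ) ∈ v2.asIdeal)
    (H : ∀ (x₀ y₀ : ℚ) (h : W.toAffine.Nonsingular x₀ y₀),
      (∃ t : ℕ, 2 ^ t • toGeomPoints W (.some x₀ y₀ h) = 0) → v2.valuation ℚ x₀ ≤ 1) :
    TwoAdicEulerCharRankZero W 0 :=
  twoAdicEulerCharRankZero_of_T1 W v2 hv2 (RationalTorsionKernelOfReduction.t1_of_forall_valuation_le_one W v2 2 H)

end TorsionEulerChar.H46LevelZero

end Summit.BirchSwinnertonDyer.BirchSwinnertonDyer.Theorems
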